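import Literature.IUT.HodgeTheaters.GaloisValDatumOfComplete
import Literature.NumberTheory.LocalFields.EquivariantUnitRigidityNormed
import Mathlib.FieldTheory.Normal.Closure
import Mathlib.Data.Set.UnionLift
import HarnessLib

/-!
# Tower gluing, extension by fractions and twisted Kummer rigidity on `k̄/k` ([IUTchI] Ex. 3.3 (iii) (e), field side)

Mochizuki, *Inter-universal Teichmüller Theory I*, kurims manuscript (May 2020), Example 3.3 (iii) p. 79
[claim: Mochizuki2012, status: disputed]: "(e) one may reconstruct the split Frobenioids `F⊢_v`, `F^Θ_v`
category-theoretically from `F_v`" — the element `p_v` being recovered through the Kummer map ([AbsTopIII] Prop. 3.2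
(iii)). In the abc-iut cell's kernel bookkeeping (sub-DAG SUBDAG-IUTchI-Ex33-Ex34 row E33iii/e) the clause is reduced
(abc-iut-L5-t16, `PadicFrobenioidSplittingTransport.lean`; abc-iut-w4-d047, `SplitReconstructibleAlongCriterion.lean`,
`GoodLocalFrobenioidOfKitSplitTransport.lean`) to the statement that the objectwise unit transports
`β_A : 𝒪^▷_{K_A} → 𝒪^▷_{K_{ΨA}}` of a self-equivalence `Ψ` of the `p_v`-adic Frobenioid `𝒞_v` send `p_v ↦ p_v`. This
file supplies the three CLASSICAL field-theoretic steps of that argument on the genuine tower `k̄/k` of [IUTchI]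
Ex. 3.3 (i) (`GaloisValDatum.ofComplete p k` of `GaloisValDatumOfComplete.lean`: `Ω = k̄ = AlgebraicClosure k` with the
valuative relation `closureVal k` of its spectral norm, `G_v = (ofComplete p k).Gal = Gal(k̄/k)`; the statements
below are spelled with `(ofComplete p k).Ω / .k / .Gal` exactly as in the consumers' files), so that the
Frobenioid-side assembly consumes them BY NAME:

* (T1) **tower gluing** `exists_lift_of_directed` — a family of maps `β i : S i → M` on subsets `S i ⊆ α`, directed
  and compatible along a refinement relation, is the restriction of ONE map on any `T ⊆ ⋃ S i` (Mathlib
  `Set.iUnionLift`); `exists_openNormalSubgroup_mem_fixedField` — every `x ∈ Ω` lies in the fixed field of an OPEN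
  NORMAL subgroup of `Gal(Ω/k)` (finite Galois sub-extensions are cofinal), so families indexed by the open normal
  subgroups (the Galois objects of `𝓑(G_v)⁰`) cover `Ω`.
* (T2) **extension by fractions** `exists_monoidWithZeroHom_extend_intNonzero` — a multiplicative nonvanishing map
  `β : 𝒪^▷_Ω → Ω` (`𝒪^▷ = PadicFrd.intNonzero`, [FrdII] Ex. 1.1 (i)) with `π ∈ 𝒪^▷_Ω` such that `πⁿ x ∈ 𝒪^▷` for
  `n ≫ 0` extends to `B : Ω →*₀ Ω` (`B x = β(πⁿx)/β(π)ⁿ`); valuation-preservation and semilinearity pass to `B`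
  (`valuation_extend_eq`, `extend_semilinear`); on `k̄` the archimedean step holds with `π = p`
  (`ofComplete_exists_pow_mul_mem_intNonzero`).
* (T3) **twisted Kummer rigidity** `map_algebraMap_eq_of_twistedEquivariant` — on `k̄`: a valuation-preserving
  `B : k̄ →*₀ k̄` with `B (a y • x) = a' y • B x` for maps `a a' : P → Gal(k̄/k)` from any type `P` with `a`
  surjective, and a valuation-preserving ring automorphism `σ` of `k̄` with `σ (a y • x) = a' y • σ x`, AGREE ON `k`
  (`C := σ⁻¹ ∘ B` is `Gal(k̄/k)`-equivariant and valuation-preserving, hence fixes `k` pointwise by abc-iut-w4-d014's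
  classical Kummer rigidity `Literature.NumberTheory.LocalFields.map_algebraMap_eq_self_of_isAlgClosure_padic`); in
  particular `B p = p` (`map_natCast_eq_of_twistedEquivariant`).

Classical valuation / Galois / Kummer theory over Mathlib and the tree (Neukirch, ANT, Ch. II (4.8), (5.7))
[cite: NeukirchANT1999, Ch. II Prop. 5.7]. Written for the abc-iut cell (seat abc-iut-w4-d047 gen 6) as the
field-currency half of abc-iut-L5-t16's row «E33iii/e hfix-genuine»; the anabelian input «`σ` exists» ([AbsTopIII]
Thm. 1.9 / Cor. 1.10 in our consequence-reading "every automorphism of `Π_v` is geometric" — a paraphrase, not a printed sentence) stays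
the CONSUMER's named hypothesis — nothing here
discharges or asserts it. PROOF-ONLY: no definition, no named fact. Nothing here asserts that abc is proved or
refuted; no side is taken on [IUTchIII] Cor. 3.12 or on any disputed claim.
-/

namespace Literature.IUT.HodgeTheaters

open Literature.AlgebraicGeometry.Frobenioids Literature.AlgebraicGeometry.Frobenioids.PadicFrd
open scoped ValuativeRel

universe u

namespace GaloisValDatum

/-! ### (T1) Tower gluing -/

section Glue

variable {α : Type*} {M : Type*} {ι : Type*} (S : ι → Set α) (β : ∀ i, S i → M) (R : ι → ι → Prop)

/-- **Tower gluing.** A family of maps `β i : S i → M` on subsets `S i ⊆ α`, DIRECTED for a refinement relation `R`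
(`R l i` = "`l` refines `i`", forcing `S i ⊆ S l`; any two indices have a common refinement) and compatible with the
inclusions `S i ⊆ S l` along `R`, is the restriction of one map `β̄ : T → M` on every `T ⊆ ⋃ S i` (Mathlib
`Set.iUnionLift`). For [IUTchI] Ex. 3.3 (iii) (e): `α = M = k̄`, `S i` = the nonzero integers of the finite Galois
extensions `K_A ⊆ k̄` of `K_v`, `R` = inclusion of open subgroups, `β i` = the unit transports of a self-equivalence of
`𝒞_v`. [cite: NeukirchANT1999, Ch. II Prop. 5.7] -/
theorem exists_lift_of_directed (hmono : ∀ l i, R l i → S i ⊆ S l) (hdir : ∀ i j, ∃ l, R l i ∧ R l j)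
    (hcompat : ∀ i l (h : R l i) (x : S i), β l ⟨x, hmono l i h x.2⟩ = β i x) (T : Set α)
    (hT : T ⊆ ⋃ i, S i) :
    ∃ βbar : T → M, ∀ i (x : T) (hx : (x : α) ∈ S i), βbar x = β i ⟨x, hx⟩ := by
  have hf : ∀ (i j) (x : α) (hxi : x ∈ S i) (hxj : x ∈ S j), β i ⟨x, hxi⟩ = β j ⟨x, hxj⟩ := by
    intro i j x hxi hxj
    obtain ⟨l, hil, hjl⟩ := hdir i j
    rw [← hcompat i l hil ⟨x, hxi⟩, ← hcompat j l hjl ⟨x, hxj⟩]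
  exact ⟨Set.iUnionLift S β hf T hT, fun i x hx => Set.iUnionLift_of_mem x hx⟩

end Glue

section Cover

variable {p : ℕ} [Fact p.Prime] (d : GaloisValDatum.{u} p)

/-- **Finite Galois sub-extensions are cofinal**: every `x ∈ Ω` lies in the fixed field of an OPEN NORMAL subgroup
of `Gal(Ω/k)` (the Galois group of the normal closure of `k(x)`, finite over `k` since `Ω/k` is Galois, hence
algebraic; open in the Krull topology). So a family indexed by the open normal subgroups — the Galois objects of
`𝓑(G_v)⁰` — covers `Ω`. [cite: NeukirchANT1999, Ch. II Prop. 5.7] -/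
theorem exists_openNormalSubgroup_mem_fixedField (x : d.Ω) :
    ∃ U : OpenNormalSubgroup d.Gal,
      x ∈ IntermediateField.fixedField (F := d.k) (E := d.Ω) (U : Subgroup d.Gal) := by
  classical
  haveI : Algebra.IsAlgebraic d.k d.Ω := Algebra.IsSeparable.isAlgebraic d.k d.Ω
  have hx : IsIntegral d.k x := (Algebra.IsAlgebraic.isAlgebraic x).isIntegral
  haveI : FiniteDimensional d.k (IntermediateField.adjoin d.k {x}) := IntermediateField.adjoin.finiteDimensional hx
  -- the normal closure `E` of `k(x)` in `Ω`: finite and Galois over `k`, contains `x`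
  obtain ⟨E, hEfin, hEnorm, hxE⟩ : ∃ E : IntermediateField d.k d.Ω,
      FiniteDimensional d.k E ∧ Normal d.k E ∧ x ∈ E :=
    ⟨IntermediateField.normalClosure d.k (IntermediateField.adjoin d.k {x}) d.Ω, inferInstance, inferInstance,
      IntermediateField.le_normalClosure _ (IntermediateField.mem_adjoin_simple_self d.k x)⟩
  haveI := hEfin
  haveI := hEnorm
  haveI : IsGalois d.k E := IsGalois.mk
  haveI hN : E.fixingSubgroup.Normal := inferInstance
  refine ⟨{ toOpenSubgroup := ⟨E.fixingSubgroup, E.fixingSubgroup_isOpen⟩, isNormal' := hN }, ?_⟩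
  rw [IntermediateField.mem_fixedField_iff]
  intro f hf
  exact (IntermediateField.mem_fixingSubgroup_iff _ _).mp hf x hxE

/-- The fixed field of a NORMAL subgroup `U ⊆ Gal(Ω/k)` is `Gal(Ω/k)`-stable: `g • K_U = K_U`.
[cite: NeukirchANT1999, Ch. II Prop. 5.7] -/
theorem smul_mem_fixedField_of_normal (U : Subgroup d.Gal) [U.Normal] (g : d.Gal) {x : d.Ω}
    (hx : x ∈ IntermediateField.fixedField (F := d.k) (E := d.Ω) U) :
    g • x ∈ IntermediateField.fixedField (F := d.k) (E := d.Ω) U := by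
  rw [IntermediateField.mem_fixedField_iff] at hx ⊢
  intro f hf
  rw [AlgEquiv.smul_def]
  have h : (g⁻¹ * f * g) x = x := hx _ (by
    have := Subgroup.Normal.conj_mem inferInstance f hf g⁻¹
    rwa [inv_inv] at this)
  have := congrArg g h
  rwa [AlgEquiv.mul_apply, AlgEquiv.mul_apply, ← AlgEquiv.mul_apply g g⁻¹, mul_inv_cancel,
    AlgEquiv.one_apply] at this

end Cover

/-! ### (T2) Extension by fractions from `𝒪^▷_Ω` to `Ω` -/

section Extend

variable {Ω : Type*} [Field Ω] [ValuativeRel Ω] (β : intNonzero Ω → Ω)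
  (hmul : ∀ x y : intNonzero Ω, β (x * y) = β x * β y)

include hmul in
/-- A multiplicative map on the monoid `𝒪^▷_Ω` of nonzero integers ([FrdII] Ex. 1.1 (i)) with `β 1 ≠ 0` sends
`1 ↦ 1`. [cite: MochizukiFrdII2008, Ex 1.1 (i) p.7] -/
theorem map_one_of_mul_of_ne_zero (h1 : β 1 ≠ 0) : β 1 = 1 := by
  have h : β 1 * β 1 = β 1 * 1 := by rw [← hmul, mul_one, mul_one]
  exact mul_left_cancel₀ h1 h

include hmul in
/-- Powers: `β (πⁿ · x) = β(π)ⁿ · β(x)` on `𝒪^▷_Ω`. [cite: MochizukiFrdII2008, Ex 1.1 (i) p.7] -/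
theorem map_pow_mul (π x : intNonzero Ω) (n : ℕ) : β (π ^ n * x) = β π ^ n * β x := by
  induction n with
  | zero => rw [pow_zero, pow_zero, one_mul, one_mul]
  | succ n ih => rw [pow_succ, mul_assoc, mul_comm π x, ← mul_assoc, hmul, ih, pow_succ]; ring

include hmul in
/-- **Well-definedness of the extension by fractions**: `β(π^m x)/β(π)^m = β(π^n x)/β(π)^n` whenever both `π^m x`
and `π^n x` are nonzero integers. [cite: MochizukiFrdII2008, Ex 1.1 (i) p.7] -/
theorem extend_wd (π : intNonzero Ω) (hπ : β π ≠ 0) {x : Ω} {m n : ℕ}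
    (hm : (π : Ω) ^ m * x ∈ intNonzero Ω) (hn : (π : Ω) ^ n * x ∈ intNonzero Ω) :
    β ⟨_, hm⟩ / β π ^ m = β ⟨_, hn⟩ / β π ^ n := by
  wlog hmn : m ≤ n generalizing m n
  · exact (this hn hm (not_le.mp hmn).le).symm
  obtain ⟨e, rfl⟩ := Nat.exists_eq_add_of_le hmn
  have hprod : (⟨_, hn⟩ : intNonzero Ω) = π ^ e * ⟨_, hm⟩ := by
    apply Subtype.ext
    change (π : Ω) ^ (m + e) * x = (π : Ω) ^ e * ((π : Ω) ^ m * x)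
    ring
  rw [hprod, map_pow_mul β hmul, pow_add, mul_comm (β π ^ m) (β π ^ e),
    mul_div_mul_left _ _ (pow_ne_zero e hπ)]

include hmul in
/-- **Extension by fractions** ([FrdII] Ex. 1.1 (i): `K^× ⊇ 𝒪^▷_K`; here with `0 ↦ 0`): a multiplicative
nonvanishing `β : 𝒪^▷_Ω → Ω` extends to a monoid-with-zero homomorphism `B : Ω →*₀ Ω`, `B x := β(πⁿx)/β(π)ⁿ`,
provided some `π ∈ 𝒪^▷_Ω` makes every nonzero `x` integral after multiplication by a power of `π` (e.g. `π = p` on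
`k̄`, `ofComplete_exists_pow_mul_mem_intNonzero`). [cite: MochizukiFrdII2008, Ex 1.1 (i) p.7] -/
theorem exists_monoidWithZeroHom_extend_intNonzero (hne : ∀ x, β x ≠ 0) (π : intNonzero Ω)
    (harch : ∀ x : Ω, x ≠ 0 → ∃ n : ℕ, (π : Ω) ^ n * x ∈ intNonzero Ω) :
    ∃ B : Ω →*₀ Ω, ∀ x : intNonzero Ω, B x = β x := by
  classical
  -- the candidate
  let f : Ω → Ω := fun x =>
    if hx : x = 0 then 0 else β ⟨_, Classical.choose_spec (harch x hx)⟩ / β π ^ Classical.choose (harch x hx)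
  have hf0 : f 0 = 0 := by simp [f]
  have hf : ∀ (x : Ω) (n : ℕ) (hn : (π : Ω) ^ n * x ∈ intNonzero Ω), f x = β ⟨_, hn⟩ / β π ^ n := by
    intro x n hn
    have hx : x ≠ 0 := by
      rintro rfl
      exact hn.2 (mul_zero _)
    simp only [f, dif_neg hx]
    exact extend_wd β hmul π (hne π) _ hn
  have hres : ∀ x : intNonzero Ω, f x = β x := by
    intro x
    have h0 : (π : Ω) ^ 0 * x ∈ intNonzero Ω := by rw [pow_zero, one_mul]; exact x.2
    rw [hf x 0 h0]
    have hx0 : (⟨(π : Ω) ^ 0 * x, h0⟩ : intNonzero Ω) = x := Subtype.ext (by simp)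
    rw [hx0, pow_zero, div_one]
  refine ⟨{ toFun := f, map_zero' := hf0, map_one' := ?_, map_mul' := ?_ }, hres⟩
  · have h1 := hres 1
    rw [Submonoid.coe_one] at h1
    rw [h1, map_one_of_mul_of_ne_zero β hmul (hne 1)]
  · intro x y
    by_cases hx : x = 0
    · rw [hx, zero_mul, hf0, zero_mul]
    by_cases hy : y = 0
    · rw [hy, mul_zero, hf0, mul_zero]
    obtain ⟨m, hm⟩ := harch x hx
    obtain ⟨n, hn⟩ := harch y hy
    have hmn : (π : Ω) ^ (m + n) * (x * y) ∈ intNonzero Ω := by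
      have := (intNonzero Ω).mul_mem hm hn
      convert this using 1
      ring
    change f (x * y) = f x * f y
    rw [hf _ _ hmn, hf x m hm, hf y n hn]
    have hprod : (⟨_, hmn⟩ : intNonzero Ω) = ⟨_, hm⟩ * ⟨_, hn⟩ :=
      Subtype.ext (by change (π : Ω) ^ (m + n) * (x * y) = (π : Ω) ^ m * x * ((π : Ω) ^ n * y); ring)
    rw [hprod, hmul, pow_add, mul_div_mul_comm]

/-- The extension is VALUATION-PRESERVING if `β` is: `v (B x) = v x` for all `x ∈ Ω`.
[cite: MochizukiFrdII2008, Ex 1.1 (i) p.7] -/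
theorem valuation_extend_eq (B : Ω →*₀ Ω) (hB : ∀ x : intNonzero Ω, B x = β x)
    (hval : ∀ x : intNonzero Ω, ValuativeRel.valuation Ω (β x) = ValuativeRel.valuation Ω x)
    (π : intNonzero Ω) (harch : ∀ x : Ω, x ≠ 0 → ∃ n : ℕ, (π : Ω) ^ n * x ∈ intNonzero Ω) (x : Ω) :
    ValuativeRel.valuation Ω (B x) = ValuativeRel.valuation Ω x := by
  by_cases hx : x = 0
  · rw [hx, map_zero]
  obtain ⟨n, hn⟩ := harch x hx
  have hπv : ValuativeRel.valuation Ω (π : Ω) ≠ 0 := (Valuation.ne_zero_iff _).mpr π.2.2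
  have key : ValuativeRel.valuation Ω (B ((π : Ω) ^ n * x)) = ValuativeRel.valuation Ω ((π : Ω) ^ n * x) := by
    rw [show B ((π : Ω) ^ n * x) = β ⟨_, hn⟩ from hB ⟨_, hn⟩, hval]
  simp only [map_mul, map_pow] at key
  rw [hB π, hval π] at key
  exact mul_left_cancel₀ (pow_ne_zero n hπv) key

/-- The extension is SEMILINEAR if `β` is: for ring endomorphisms `τ, τ'` of `Ω` with `τ π = π`, `τ(𝒪^▷) ⊆ 𝒪^▷`
and `β (τ z) = τ' (β z)` on `𝒪^▷`, one has `B (τ x) = τ' (B x)` for all `x ∈ Ω` (note `τ' (β π) = β π`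
automatically). [cite: MochizukiFrdII2008, Ex 1.1 (i) p.7] -/
theorem extend_semilinear (hne : ∀ x, β x ≠ 0) (B : Ω →*₀ Ω) (hB : ∀ x : intNonzero Ω, B x = β x)
    (π : intNonzero Ω) (harch : ∀ x : Ω, x ≠ 0 → ∃ n : ℕ, (π : Ω) ^ n * x ∈ intNonzero Ω)
    (τ τ' : Ω →+* Ω) (hτπ : τ π = π) (hτ : ∀ z : intNonzero Ω, τ z ∈ intNonzero Ω)
    (hequiv : ∀ z : intNonzero Ω, β ⟨τ z, hτ z⟩ = τ' (β z)) (x : Ω) : B (τ x) = τ' (B x) := by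
  by_cases hx : x = 0
  · rw [hx, map_zero, map_zero, map_zero]
  obtain ⟨n, hn⟩ := harch x hx
  have hπ' : τ' (β π) = β π := by
    have h := hequiv π
    have hτπ' : (⟨τ π, hτ π⟩ : intNonzero Ω) = π := Subtype.ext hτπ
    rw [hτπ'] at h
    exact h.symm
  have hBπ : B π ≠ 0 := by rw [hB π]; exact hne π
  -- `τ (πⁿ x) = πⁿ τ x` is a nonzero integer
  have hn' : (π : Ω) ^ n * τ x ∈ intNonzero Ω := by
    have := hτ ⟨_, hn⟩
    rwa [show ((⟨_, hn⟩ : intNonzero Ω) : Ω) = (π : Ω) ^ n * x from rfl, map_mul, map_pow, hτπ] at this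
  have h1 : B ((π : Ω) ^ n * τ x) = τ' (B ((π : Ω) ^ n * x)) := by
    rw [show B ((π : Ω) ^ n * τ x) = β ⟨_, hn'⟩ from hB ⟨_, hn'⟩,
      show B ((π : Ω) ^ n * x) = β ⟨_, hn⟩ from hB ⟨_, hn⟩, ← hequiv ⟨_, hn⟩]
    congr 1
    apply Subtype.ext
    change (π : Ω) ^ n * τ x = τ ((π : Ω) ^ n * x)
    rw [map_mul, map_pow, hτπ]
  simp only [map_mul, map_pow] at h1
  rw [hB π, hπ', ← hB π] at h1
  exact mul_left_cancel₀ (pow_ne_zero n hBπ) h1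

end Extend

/-! ### (T3) Twisted Kummer rigidity on `k̄/k`

Everything below is stated for the genuine datum `d := GaloisValDatum.ofComplete p k` (`d.Ω = k̄ = AlgebraicClosure k`
with the valuative relation `closureVal k` of its spectral norm, `d.Gal = Gal(k̄/k)`, `d.k = k`), in the SAME spelling as
the consumers' files (`GoodLocalFrobenioidOfGaloisBaseRam`, `…UnitTransport`); the few norm computations are done on
the literal carrier `AlgebraicClosure k` (spelling of `closureVal_iff`) and transported by `rfl`. -/

section Closure

variable (p : ℕ) [Fact p.Prime] (k : Type) [NontriviallyNormedField k] [CompleteSpace k] [IsUltrametricDist k]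
  [NormedAlgebra ℚ_[p] k] [FiniteDimensional ℚ_[p] k]

omit [NormedAlgebra ℚ_[p] k] [FiniteDimensional ℚ_[p] k] in
/-- On `k̄` the spectral valuation compares elements of `k` like the norm of `k` (Mathlib `spectralNorm_extends`) —
the `hcompat` input of the classical Kummer rigidity. [cite: NeukirchANT1999, Ch. II Thm. (4.8)] -/
theorem closure_valuation_algebraMap_le_iff (c e : k) :
    @ValuativeRel.valuation (AlgebraicClosure k) _ (closureVal k) (algebraMap k (AlgebraicClosure k) c) ≤
        @ValuativeRel.valuation (AlgebraicClosure k) _ (closureVal k) (algebraMap k (AlgebraicClosure k) e) ↔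
      ‖c‖ ≤ ‖e‖ := by
  letI : ValuativeRel (AlgebraicClosure k) := closureVal k
  rw [← Valuation.Compatible.vle_iff_le, closureVal_iff, spectralNorm_extends, spectralNorm_extends]

/-- **The archimedean step on `k̄`** (literal carrier): for every nonzero `x ∈ k̄` some `pⁿ x` is a nonzero integer
(`‖p‖ < 1` and the spectral norm is real-valued). [cite: NeukirchANT1999, Ch. II Thm. (4.8)] -/
theorem closure_exists_pow_mul_mem_intNonzero (x : AlgebraicClosure k) (hx : x ≠ 0) :
    ∃ n : ℕ, ((p : ℕ) : AlgebraicClosure k) ^ n * x ∈ @intNonzero (AlgebraicClosure k) _ (closureVal k) := by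
  letI : ValuativeRel (AlgebraicClosure k) := closureVal k
  letI := closureNormedField k
  have hp0 : ((p : ℕ) : AlgebraicClosure k) ≠ 0 := (ofComplete p k).p_ne_zero_Ω
  have hp : ‖((p : ℕ) : AlgebraicClosure k)‖ < 1 := by
    change spectralNorm k (AlgebraicClosure k) ((p : ℕ) : AlgebraicClosure k) < 1
    rw [← map_natCast (algebraMap k (AlgebraicClosure k)), spectralNorm_extends]
    exact norm_p_lt_one p k
  have hx' : (0 : ℝ) < ‖x‖ := norm_pos_iff.mpr hx
  obtain ⟨n, hn⟩ := exists_pow_lt_of_lt_one (inv_pos.mpr hx') hp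
  refine ⟨n, ?_, mul_ne_zero (pow_ne_zero _ hp0) hx⟩
  rw [← (ValuativeRel.valuation _).map_one, ← Valuation.Compatible.vle_iff_le, closureVal_iff]
  change ‖((p : ℕ) : AlgebraicClosure k) ^ n * x‖ ≤ ‖(1 : AlgebraicClosure k)‖
  rw [norm_one, norm_mul, norm_pow]
  calc ‖((p : ℕ) : AlgebraicClosure k)‖ ^ n * ‖x‖ ≤ ‖x‖⁻¹ * ‖x‖ := mul_le_mul_of_nonneg_right hn.le hx'.le
    _ = 1 := inv_mul_cancel₀ hx'.ne'

end Closure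

section OfComplete

variable (p : ℕ) [Fact p.Prime] (k : Type) [NontriviallyNormedField k] [CompleteSpace k] [IsUltrametricDist k]
  [NormedAlgebra ℚ_[p] k] [FiniteDimensional ℚ_[p] k]

/-- Galois automorphisms of `k̄/k` preserve the valuation of the genuine datum (Mathlib `spectralNorm_eq_of_equiv`).
[cite: NeukirchANT1999, Ch. II Thm. (4.8)] -/
theorem ofComplete_valuation_algEquiv_eq (g : (ofComplete p k).Gal) (x : (ofComplete p k).Ω) :
    ValuativeRel.valuation (ofComplete p k).Ω (g x) = ValuativeRel.valuation (ofComplete p k).Ω x := by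
  -- read on the literal carrier `AlgebraicClosure k` (Mathlib's instances), transported by `rfl`
  have h := spectralNorm_eq_of_equiv (show AlgebraicClosure k ≃ₐ[k] AlgebraicClosure k from g)
    (show AlgebraicClosure k from x)
  apply le_antisymm
  · rw [← Valuation.Compatible.vle_iff_le]
    change @ValuativeRel.vle _ _ (closureVal k) _ _
    rw [closureVal_iff]
    exact h.ge
  · rw [← Valuation.Compatible.vle_iff_le]
    change @ValuativeRel.vle _ _ (closureVal k) _ _
    rw [closureVal_iff]
    exact h.le

/-- Galois automorphisms of `k̄/k` preserve `𝒪^▷_{k̄}`. [cite: MochizukiFrdII2008, Ex 1.1 (i) p.7] -/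
theorem ofComplete_algEquiv_mem_intNonzero (g : (ofComplete p k).Gal) {x : (ofComplete p k).Ω}
    (hx : x ∈ intNonzero (ofComplete p k).Ω) : g x ∈ intNonzero (ofComplete p k).Ω :=
  ⟨by rw [ofComplete_valuation_algEquiv_eq]; exact hx.1, (map_ne_zero_iff g g.injective).mpr hx.2⟩

/-- `p ∈ 𝒪^▷_{k̄}`. [cite: MochizukiFrdII2008, Ex 1.1 (i) p.7] -/
theorem ofComplete_natCast_mem_intNonzero : ((p : ℕ) : (ofComplete p k).Ω) ∈ intNonzero (ofComplete p k).Ω := by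
  refine ⟨?_, (ofComplete p k).p_ne_zero_Ω⟩
  rw [← (ValuativeRel.valuation _).map_one, ← Valuation.Compatible.vle_iff_le]
  exact (ofComplete p k).p_vle_one_Ω.1

/-- `p ∈ K_U ∩ 𝒪^▷_{k̄}` for every subgroup `U ⊆ Gal(k̄/k)` (`p ∈ k`). [cite: MochizukiFrdII2008, Ex 1.1 (i) p.7] -/
theorem ofComplete_natCast_mem_fixedField_inter (U : Subgroup (ofComplete p k).Gal) :
    ((p : ℕ) : (ofComplete p k).Ω) ∈
      (IntermediateField.fixedField (F := (ofComplete p k).k) (E := (ofComplete p k).Ω) U : Set (ofComplete p k).Ω) ∩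
        (intNonzero (ofComplete p k).Ω : Set (ofComplete p k).Ω) :=
  ⟨by
    rw [SetLike.mem_coe, IntermediateField.mem_fixedField_iff]
    intro f _
    exact map_natCast f p, ofComplete_natCast_mem_intNonzero p k⟩

/-- **The archimedean step on `k̄`**: for every nonzero `x ∈ k̄` some `pⁿ x` is a nonzero integer — the input `harch`
of `exists_monoidWithZeroHom_extend_intNonzero` with `π = p`. [cite: NeukirchANT1999, Ch. II Thm. (4.8)] -/
theorem ofComplete_exists_pow_mul_mem_intNonzero (x : (ofComplete p k).Ω) (hx : x ≠ 0) :
    ∃ n : ℕ, ((p : ℕ) : (ofComplete p k).Ω) ^ n * x ∈ intNonzero (ofComplete p k).Ω :=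
  closure_exists_pow_mul_mem_intNonzero p k x hx

/-- **Twisted Kummer rigidity on `k̄/k`.** Let `B : k̄ →*₀ k̄` be multiplicative and valuation-preserving, and
semilinear along a pair of maps `a, a' : P → G_v = Gal(k̄/k)` from any type `P` with `a` surjective:
`B (a y • x) = a' y • B x` (for [IUTchI] Ex. 3.3 (iii) (e): `P = Π_v`, `a` = the augmentation `Π_v ↠ G_v`, `a' = a ∘ φ`
for the automorphism `φ` of `Π_v` induced by a self-equivalence of `𝒞_v`; `B` = the glued unit transport). Let `σ` be
a valuation-preserving ring automorphism of `k̄` with the SAME semilinearity `σ (a y • x) = a' y • σ x` (the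
consumer's anabelian input «`φ` is geometric», [AbsTopIII] Thm. 1.9 / Cor. 1.10 — a hypothesis here). Then `B` and `σ`
agree on `k`: `C := σ⁻¹ ∘ B` is `Gal(k̄/k)`-equivariant and valuation-preserving, so it fixes `k` pointwise by the
classical Kummer rigidity (`Literature.NumberTheory.LocalFields.map_algebraMap_eq_self_of_isAlgClosure_padic`,
abc-iut-w4-d014). [cite: NeukirchANT1999, Ch. II Prop. 5.7] -/
theorem map_algebraMap_eq_of_twistedEquivariant (B : (ofComplete p k).Ω →*₀ (ofComplete p k).Ω)
    (hBv : ∀ x, ValuativeRel.valuation (ofComplete p k).Ω (B x) = ValuativeRel.valuation (ofComplete p k).Ω x)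
    {P : Type*} (a a' : P → (ofComplete p k).Gal) (ha : Function.Surjective a)
    (hB : ∀ (y : P) (x : (ofComplete p k).Ω), B (a y • x) = a' y • B x)
    (σ : (ofComplete p k).Ω ≃+* (ofComplete p k).Ω)
    (hσv : ∀ x, ValuativeRel.valuation (ofComplete p k).Ω (σ x) = ValuativeRel.valuation (ofComplete p k).Ω x)
    (hσ : ∀ (y : P) (x : (ofComplete p k).Ω), σ (a y • x) = a' y • σ x) (c : (ofComplete p k).k) :
    B (algebraMap (ofComplete p k).k (ofComplete p k).Ω c) = σ (algebraMap (ofComplete p k).k (ofComplete p k).Ω c) := by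
  -- `C := σ⁻¹ ∘ B`
  let C : (ofComplete p k).Ω →*₀ (ofComplete p k).Ω := σ.symm.toMonoidWithZeroHom.comp B
  have hCdef : ∀ x, C x = σ.symm (B x) := fun _ => rfl
  have hCeq : ∀ (g : (ofComplete p k).Gal) (x : (ofComplete p k).Ω), C (g x) = g (C x) := by
    intro g x
    obtain ⟨y, rfl⟩ := ha g
    rw [hCdef, hCdef]
    have h1 : B (a y • x) = a' y • B x := hB y x
    rw [AlgEquiv.smul_def, AlgEquiv.smul_def] at h1
    rw [h1]
    apply σ.injective
    rw [RingEquiv.apply_symm_apply]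
    have h2 := hσ y (σ.symm (B x))
    rw [AlgEquiv.smul_def, AlgEquiv.smul_def, RingEquiv.apply_symm_apply] at h2
    exact h2.symm
  have hCv : ∀ x, ValuativeRel.valuation (ofComplete p k).Ω (C x) = ValuativeRel.valuation (ofComplete p k).Ω x := by
    intro x
    rw [hCdef, ← hBv x]
    conv_rhs => rw [← σ.apply_symm_apply (B x)]
    rw [hσv]
  -- the classical Kummer rigidity, read on the literal carrier `k̄ = AlgebraicClosure k`
  have key : C (algebraMap (ofComplete p k).k (ofComplete p k).Ω c) = algebraMap (ofComplete p k).k (ofComplete p k).Ω c :=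
    Literature.NumberTheory.LocalFields.map_algebraMap_eq_self_of_isAlgClosure_padic (k := k)
      (L := AlgebraicClosure k) p (@ValuativeRel.valuation (AlgebraicClosure k) _ (closureVal k))
      (closure_valuation_algebraMap_le_iff k) C hCeq hCv c
  rw [hCdef] at key
  calc B (algebraMap (ofComplete p k).k (ofComplete p k).Ω c)
        = σ (σ.symm (B (algebraMap (ofComplete p k).k (ofComplete p k).Ω c))) := (σ.apply_symm_apply _).symm
    _ = σ (algebraMap (ofComplete p k).k (ofComplete p k).Ω c) := by rw [key]

/-- In particular `B p = p` (`σ` is a ring automorphism, so `σ p = p`). [cite: NeukirchANT1999, Ch. II Prop. 5.7] -/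
theorem map_natCast_eq_of_twistedEquivariant (B : (ofComplete p k).Ω →*₀ (ofComplete p k).Ω)
    (hBv : ∀ x, ValuativeRel.valuation (ofComplete p k).Ω (B x) = ValuativeRel.valuation (ofComplete p k).Ω x)
    {P : Type*} (a a' : P → (ofComplete p k).Gal) (ha : Function.Surjective a)
    (hB : ∀ (y : P) (x : (ofComplete p k).Ω), B (a y • x) = a' y • B x)
    (σ : (ofComplete p k).Ω ≃+* (ofComplete p k).Ω)
    (hσv : ∀ x, ValuativeRel.valuation (ofComplete p k).Ω (σ x) = ValuativeRel.valuation (ofComplete p k).Ω x)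
    (hσ : ∀ (y : P) (x : (ofComplete p k).Ω), σ (a y • x) = a' y • σ x) :
    B ((p : ℕ) : (ofComplete p k).Ω) = (p : ℕ) := by
  have h := map_algebraMap_eq_of_twistedEquivariant p k B hBv a a' ha hB σ hσv hσ (p : ℕ)
  rw [map_natCast (algebraMap (ofComplete p k).k (ofComplete p k).Ω)] at h
  rw [h, map_natCast σ]

/-! ### Assembly: a tower of unit transports sends `p ↦ p` -/

/-- **A tower of twisted-equivariant unit transports fixes `p`** — the field-currency half of [IUTchI] Ex. 3.3
(iii) (e) at the genuine datum `k̄/K_v` (`K_v = k`). DATA: for every open normal subgroup `U ⊆ G_v = Gal(k̄/k)` (the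
Galois objects `Spec K_U`, `K_U := k̄^U`, of `𝓑(G_v)⁰` — a cofinal family) a map `β U` on `K_U ∩ 𝒪^▷_{k̄}` with
values in `k̄` (the STRAIGHTENED unit transport of a self-equivalence `Ψ` of `𝒞_v` on the Frobenioid object over
`Spec K_U`), such that `β` is compatible with the inclusions `K_V ⊆ K_U` (`U ⊆ V`), multiplicative, valuation-preserving,
and semilinear along `(a, a')` (`= (aug, aug ∘ φ)` from `P = Π_v`, `aug : Π_v ↠ G_v` surjective);
HYPOTHESIS: a valuation-preserving ring automorphism `σ` of `k̄` with the same semilinearity (the consumer's anabelian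
input, [AbsTopIII] Thm. 1.9 / Cor. 1.10). CONCLUSION: `β U p = p` for every `U` — i.e. `Ψ` fixes the image of `p_v`
in every `𝒪^▷_{K_U}`, the hypothesis `H` of abc-iut-L5-t16's `PadicFrobenioidSplittingTransport` object by object.
Proof: (T1) glue the `β U` to `β̄` on `𝒪^▷_{k̄}` (the `K_U` cover `k̄`: `exists_openNormalSubgroup_mem_fixedField`),
(T2) extend by fractions to `B : k̄ →*₀ k̄`, (T3) twisted Kummer rigidity. [cite: Mochizuki2012, I Ex 3.3 (iii) p.79] -/
theorem tower_map_natCast_eq_of_twistedEquivariant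
    (β : ∀ U : OpenNormalSubgroup (ofComplete p k).Gal,
      ↥((IntermediateField.fixedField (F := (ofComplete p k).k) (E := (ofComplete p k).Ω)
            (U : Subgroup (ofComplete p k).Gal) : Set (ofComplete p k).Ω) ∩
          (intNonzero (ofComplete p k).Ω : Set (ofComplete p k).Ω)) → (ofComplete p k).Ω)
    (hcompat : ∀ (U V : OpenNormalSubgroup (ofComplete p k).Gal) (_hUV : U ≤ V) (x : (ofComplete p k).Ω)
      (hxU : x ∈ (IntermediateField.fixedField (F := (ofComplete p k).k) (E := (ofComplete p k).Ω)
            (U : Subgroup (ofComplete p k).Gal) : Set (ofComplete p k).Ω) ∩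
          (intNonzero (ofComplete p k).Ω : Set (ofComplete p k).Ω))
      (hxV : x ∈ (IntermediateField.fixedField (F := (ofComplete p k).k) (E := (ofComplete p k).Ω)
            (V : Subgroup (ofComplete p k).Gal) : Set (ofComplete p k).Ω) ∩
          (intNonzero (ofComplete p k).Ω : Set (ofComplete p k).Ω)),
      β U ⟨x, hxU⟩ = β V ⟨x, hxV⟩)
    (hmul : ∀ (U : OpenNormalSubgroup (ofComplete p k).Gal) (x y : (ofComplete p k).Ω)
      (hx : x ∈ (IntermediateField.fixedField (F := (ofComplete p k).k) (E := (ofComplete p k).Ω)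
            (U : Subgroup (ofComplete p k).Gal) : Set (ofComplete p k).Ω) ∩
          (intNonzero (ofComplete p k).Ω : Set (ofComplete p k).Ω))
      (hy : y ∈ (IntermediateField.fixedField (F := (ofComplete p k).k) (E := (ofComplete p k).Ω)
            (U : Subgroup (ofComplete p k).Gal) : Set (ofComplete p k).Ω) ∩
          (intNonzero (ofComplete p k).Ω : Set (ofComplete p k).Ω))
      (hxy : x * y ∈ (IntermediateField.fixedField (F := (ofComplete p k).k) (E := (ofComplete p k).Ω)
            (U : Subgroup (ofComplete p k).Gal) : Set (ofComplete p k).Ω) ∩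
          (intNonzero (ofComplete p k).Ω : Set (ofComplete p k).Ω)),
      β U ⟨x * y, hxy⟩ = β U ⟨x, hx⟩ * β U ⟨y, hy⟩)
    (hval : ∀ (U : OpenNormalSubgroup (ofComplete p k).Gal) (x : (ofComplete p k).Ω)
      (hx : x ∈ (IntermediateField.fixedField (F := (ofComplete p k).k) (E := (ofComplete p k).Ω)
            (U : Subgroup (ofComplete p k).Gal) : Set (ofComplete p k).Ω) ∩
          (intNonzero (ofComplete p k).Ω : Set (ofComplete p k).Ω)),
      ValuativeRel.valuation (ofComplete p k).Ω (β U ⟨x, hx⟩) = ValuativeRel.valuation (ofComplete p k).Ω x)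
    {P : Type*} (a a' : P → (ofComplete p k).Gal) (ha : Function.Surjective a)
    (hequiv : ∀ (U : OpenNormalSubgroup (ofComplete p k).Gal) (y : P) (x : (ofComplete p k).Ω)
      (hx : x ∈ (IntermediateField.fixedField (F := (ofComplete p k).k) (E := (ofComplete p k).Ω)
            (U : Subgroup (ofComplete p k).Gal) : Set (ofComplete p k).Ω) ∩
          (intNonzero (ofComplete p k).Ω : Set (ofComplete p k).Ω))
      (hyx : a y • x ∈ (IntermediateField.fixedField (F := (ofComplete p k).k) (E := (ofComplete p k).Ω)
            (U : Subgroup (ofComplete p k).Gal) : Set (ofComplete p k).Ω) ∩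
          (intNonzero (ofComplete p k).Ω : Set (ofComplete p k).Ω)),
      β U ⟨a y • x, hyx⟩ = a' y • β U ⟨x, hx⟩)
    (σ : (ofComplete p k).Ω ≃+* (ofComplete p k).Ω)
    (hσv : ∀ x, ValuativeRel.valuation (ofComplete p k).Ω (σ x) = ValuativeRel.valuation (ofComplete p k).Ω x)
    (hσ : ∀ (y : P) (x : (ofComplete p k).Ω), σ (a y • x) = a' y • σ x)
    (U : OpenNormalSubgroup (ofComplete p k).Gal)
    (hpU : ((p : ℕ) : (ofComplete p k).Ω) ∈ (IntermediateField.fixedField (F := (ofComplete p k).k)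
            (E := (ofComplete p k).Ω) (U : Subgroup (ofComplete p k).Gal) : Set (ofComplete p k).Ω) ∩
          (intNonzero (ofComplete p k).Ω : Set (ofComplete p k).Ω)) :
    β U ⟨(p : ℕ), hpU⟩ = (p : ℕ) := by
  -- membership bookkeeping for `S U := K_U ∩ 𝒪^▷`
  have hmono : ∀ W U : OpenNormalSubgroup (ofComplete p k).Gal, W ≤ U →
      (IntermediateField.fixedField (F := (ofComplete p k).k) (E := (ofComplete p k).Ω)
            (U : Subgroup (ofComplete p k).Gal) : Set (ofComplete p k).Ω) ∩
          (intNonzero (ofComplete p k).Ω : Set (ofComplete p k).Ω) ⊆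
        (IntermediateField.fixedField (F := (ofComplete p k).k) (E := (ofComplete p k).Ω)
            (W : Subgroup (ofComplete p k).Gal) : Set (ofComplete p k).Ω) ∩
          (intNonzero (ofComplete p k).Ω : Set (ofComplete p k).Ω) := by
    intro W U hWU x hx
    refine ⟨?_, hx.2⟩
    have h1 := hx.1
    rw [SetLike.mem_coe, IntermediateField.mem_fixedField_iff] at h1 ⊢
    exact fun f hf => h1 f (hWU hf)
  have hcov := (ofComplete p k).exists_openNormalSubgroup_mem_fixedField
  have hstab : ∀ (U : OpenNormalSubgroup (ofComplete p k).Gal) (g : (ofComplete p k).Gal) {x : (ofComplete p k).Ω},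
      x ∈ IntermediateField.fixedField (F := (ofComplete p k).k) (E := (ofComplete p k).Ω)
        (U : Subgroup (ofComplete p k).Gal) →
      g • x ∈ IntermediateField.fixedField (F := (ofComplete p k).k) (E := (ofComplete p k).Ω)
        (U : Subgroup (ofComplete p k).Gal) :=
    fun U g _ hx => (ofComplete p k).smul_mem_fixedField_of_normal (U : Subgroup (ofComplete p k).Gal) g hx
  -- (T1) glue
  obtain ⟨βbar, hres⟩ := exists_lift_of_directed
    (fun U : OpenNormalSubgroup (ofComplete p k).Gal =>
      (IntermediateField.fixedField (F := (ofComplete p k).k) (E := (ofComplete p k).Ω)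
            (U : Subgroup (ofComplete p k).Gal) : Set (ofComplete p k).Ω) ∩
          (intNonzero (ofComplete p k).Ω : Set (ofComplete p k).Ω))
    β (fun W U => W ≤ U) hmono (fun U V => ⟨U ⊓ V, inf_le_left, inf_le_right⟩)
    (fun U W h x => hcompat W U h x (hmono W U h x.2) x.2)
    (intNonzero (ofComplete p k).Ω : Set (ofComplete p k).Ω)
    (fun x hx => by
      obtain ⟨U, hU⟩ := hcov x
      exact Set.mem_iUnion.2 ⟨U, hU, hx⟩)
  -- the glued map on the monoid `𝒪^▷_{k̄}`
  let βb : intNonzero (ofComplete p k).Ω → (ofComplete p k).Ω := fun x => βbar ⟨x, x.2⟩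
  have hβb : ∀ (U : OpenNormalSubgroup (ofComplete p k).Gal) (x : intNonzero (ofComplete p k).Ω)
      (hx : (x : (ofComplete p k).Ω) ∈ IntermediateField.fixedField (F := (ofComplete p k).k)
        (E := (ofComplete p k).Ω) (U : Subgroup (ofComplete p k).Gal)),
      βb x = β U ⟨x, hx, x.2⟩ := fun U x hx => hres U ⟨x, x.2⟩ ⟨hx, x.2⟩
  -- multiplicativity of the glued map
  have hmulb : ∀ x y : intNonzero (ofComplete p k).Ω, βb (x * y) = βb x * βb y := by
    intro x y
    obtain ⟨Ux, hUx⟩ := hcov (x : (ofComplete p k).Ω)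
    obtain ⟨Uy, hUy⟩ := hcov (y : (ofComplete p k).Ω)
    have hx : (x : (ofComplete p k).Ω) ∈ IntermediateField.fixedField (F := (ofComplete p k).k)
        (E := (ofComplete p k).Ω) ((Ux ⊓ Uy : OpenNormalSubgroup _) : Subgroup (ofComplete p k).Gal) :=
      (hmono _ _ inf_le_left ⟨hUx, x.2⟩).1
    have hy : (y : (ofComplete p k).Ω) ∈ IntermediateField.fixedField (F := (ofComplete p k).k)
        (E := (ofComplete p k).Ω) ((Ux ⊓ Uy : OpenNormalSubgroup _) : Subgroup (ofComplete p k).Gal) :=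
      (hmono _ _ inf_le_right ⟨hUy, y.2⟩).1
    have hxy : ((x * y : intNonzero (ofComplete p k).Ω) : (ofComplete p k).Ω) ∈
        IntermediateField.fixedField (F := (ofComplete p k).k) (E := (ofComplete p k).Ω)
          ((Ux ⊓ Uy : OpenNormalSubgroup _) : Subgroup (ofComplete p k).Gal) := by
      rw [Submonoid.coe_mul]
      exact mul_mem hx hy
    rw [hβb _ _ hxy, hβb _ x hx, hβb _ y hy]
    exact hmul _ x y ⟨hx, x.2⟩ ⟨hy, y.2⟩ ⟨by rw [← Submonoid.coe_mul]; exact hxy, (x * y).2⟩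
  -- valuation-preservation and nonvanishing of the glued map
  have hvalb : ∀ x : intNonzero (ofComplete p k).Ω,
      ValuativeRel.valuation (ofComplete p k).Ω (βb x) = ValuativeRel.valuation (ofComplete p k).Ω x := by
    intro x
    obtain ⟨Ux, hUx⟩ := hcov (x : (ofComplete p k).Ω)
    rw [hβb Ux x hUx]
    exact hval Ux x ⟨hUx, x.2⟩
  have hneb : ∀ x : intNonzero (ofComplete p k).Ω, βb x ≠ 0 := fun x =>
    (Valuation.ne_zero_iff _).mp (by rw [hvalb x]; exact (Valuation.ne_zero_iff _).mpr x.2.2)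
  -- (T2) extend by fractions with `π := p`
  have harch := ofComplete_exists_pow_mul_mem_intNonzero p k
  obtain ⟨B, hB⟩ := exists_monoidWithZeroHom_extend_intNonzero βb hmulb hneb
    ⟨(p : ℕ), ofComplete_natCast_mem_intNonzero p k⟩ harch
  have hBv := valuation_extend_eq βb B hB hvalb ⟨(p : ℕ), ofComplete_natCast_mem_intNonzero p k⟩ harch
  -- semilinearity of `B` along `(a, a')`
  have hBsemi : ∀ (y : P) (x : (ofComplete p k).Ω), B (a y • x) = a' y • B x := by
    intro y x
    rw [AlgEquiv.smul_def, AlgEquiv.smul_def]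
    refine extend_semilinear βb hneb B hB ⟨(p : ℕ), ofComplete_natCast_mem_intNonzero p k⟩ harch
      (a y : (ofComplete p k).Ω →+* (ofComplete p k).Ω) (a' y : (ofComplete p k).Ω →+* (ofComplete p k).Ω)
      (map_natCast (a y) p) (fun z => ofComplete_algEquiv_mem_intNonzero p k (a y) z.2) (fun z => ?_) x
    obtain ⟨Uz, hUz⟩ := hcov (z : (ofComplete p k).Ω)
    have hz' : a y • (z : (ofComplete p k).Ω) ∈ IntermediateField.fixedField (F := (ofComplete p k).k)
        (E := (ofComplete p k).Ω) (Uz : Subgroup (ofComplete p k).Gal) := hstab Uz (a y) hUz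
    change βb ⟨a y • (z : (ofComplete p k).Ω), _⟩ = (a' y) (βb z)
    rw [hβb Uz _ hz', hβb Uz z hUz, ← AlgEquiv.smul_def]
    exact hequiv Uz y z ⟨hUz, z.2⟩ ⟨hz', ofComplete_algEquiv_mem_intNonzero p k (a y) z.2⟩
  -- (T3) twisted Kummer rigidity
  have hBp := map_natCast_eq_of_twistedEquivariant p k B hBv a a' ha hBsemi σ hσv hσ
  calc β U ⟨(p : ℕ), hpU⟩
        = βb ⟨(p : ℕ), ofComplete_natCast_mem_intNonzero p k⟩ :=
          (hβb U ⟨(p : ℕ), ofComplete_natCast_mem_intNonzero p k⟩ hpU.1).symm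
    _ = B ((p : ℕ) : (ofComplete p k).Ω) := (hB _).symm
    _ = (p : ℕ) := hBp

end OfComplete

end GaloisValDatum

end Literature.IUT.HodgeTheaters
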